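import Summits.CriticalPhenomena.PercolationContinuityZ3.Theorems.PercNearOneGluingNearOneGluingLogGluing
import Summits.CriticalPhenomena.PercolationContinuityZ3.Theorems.PercNearOneGluingNearOneGluingFreshPocketAveraging
import HarnessLib

/-!
# Crux `PercNearOneGluing.NoHeavyLowerTail` (stmt-CriticalPhenomena-4575), line `comonotone-deadzone` —
# the LEVEL DICHOTOMY: bad ≤ level profile + bad event of the reliability ball

Prover `prover-rtask-CriticalPhenomena-PercNearOneG-529c20ca-0` (strategy (a), domination), 2026-08-17.
Lands with `--supports stmt-CriticalPhenomena-4575 --as helper`.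

Notation: `μ = prodBernoulli w` on bond configurations of the complete graph on `Fin n`, relay set `A`,
observer `o`, target `b`, `u(v) = μ(v ↮ b)`, level set `L_η = {v | η ≤ u(v)} ∪ {o}`, reliability ball
`R_η = {v | u(v) < η}`.

* `bad_le_levelProfile_add_badBall` — for every threshold `η`,
  `μ(o ↔ A, o ↮ b) ≤ μ(o ↔ A inside L_η) + μ(o ↔ R_η, o ↮ b)`:
  an open path from `o` to `A` either stays inside the level set, or visits an `η`-reliable vertex, which
  is then a DEAD `η`-reliable vertex joined to `o`.  (Pointwise inclusion of events.)
* `bad_le_levelProfile_add_logBall` — with the landed window bound (`windowBound`, BHK + dyadic thinning):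
  `μ(o ↔ A, o ↮ b) ≤ μ(o ↔ A inside L_η) + 16 (⌊log₂ |R_η|⌋ + 1) η` for `0 ≤ η`, with NO hypothesis on the
  instance: the bad event is controlled by ONE value of the level profile plus a logarithmic price in the
  number of `η`-reliable vertices.

Consequence for the line: the registered weak stub `stub_comonotoneDeadZoneWeak`
(`∫₀¹ μ(o ↔ A inside L_t) dt ≤ η(ε) ⇒ bad ≤ ε`) is EQUIVALENT to hub gluing for reliability balls
(`μ(o ↔ R_η, o ↮ b) → 0` uniformly as `η → 0`), i.e. to the crux in level-set form (the first summand is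
`≤ (∫₀¹ …)/η` by monotonicity of the profile); the strong stub S2 is the genuinely stronger domination
statement.
-/

namespace Summit.CriticalPhenomena.PercolationContinuityZ3.Theorems

open scoped BigOperators Classical
open MeasureTheory Set
open Literature.Probability.LatticeModels (prodBernoulli)
open Literature.Probability.Percolation
open Literature.Barriers.CriticalPhenomena (pathIn_of_walk_support_subset)

section LevelDichotomy

variable {n : ℕ}

/-- **Level dichotomy (pointwise).**  An open path from `o` to `A` in a configuration with `o ↮ b` either
stays inside the level set `{η ≤ u} ∪ {o}` or passes through an `η`-reliable vertex joined to `o` and cut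
from `b`. [folklore] -/
theorem bad_subset_levelProfile_union_badBall (w : Sym2 (Fin n) → unitInterval) (A : Finset (Fin n))
    (o b : Fin n) (η : ℝ) :
    ((⋃ a ∈ A, openConn o a) ∩ (openConn o b)ᶜ : Set (BondConfig (Fin n))) ⊆
      (⋃ a ∈ A, openConnIn ({v : Fin n | η ≤ (prodBernoulli w).real (openConn v b)ᶜ} ∪ {o}) o a) ∪
        ((⋃ v ∈ (Finset.univ : Finset (Fin n)).filter
            (fun v => (prodBernoulli w).real (openConn v b)ᶜ < η), openConn o v) ∩ (openConn o b)ᶜ) := by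
  rintro ω ⟨hA, hb⟩
  rw [Set.mem_iUnion₂] at hA
  obtain ⟨a, ha, hoa⟩ := hA
  obtain ⟨p⟩ := (hoa : (openGraph ω).Reachable o a)
  by_cases hall : ∀ v ∈ p.support,
      v ∈ ({v : Fin n | η ≤ (prodBernoulli w).real (openConn v b)ᶜ} ∪ {o})
  · left
    rw [Set.mem_iUnion₂]
    exact ⟨a, ha, DCT16.mem_openConnIn_of_pathIn (pathIn_of_walk_support_subset p hall)⟩
  · right
    push Not at hall
    obtain ⟨v, hv, hvL⟩ := hall
    have hvη : (prodBernoulli w).real (openConn v b)ᶜ < η := by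
      by_contra hge
      exact hvL (Or.inl (not_lt.1 hge))
    refine ⟨?_, hb⟩
    rw [Set.mem_iUnion₂]
    exact ⟨v, Finset.mem_filter.2 ⟨Finset.mem_univ _, hvη⟩, ⟨p.takeUntil v hv⟩⟩

/-- **Level dichotomy.**  For every threshold `η`,
`μ(o ↔ A, o ↮ b) ≤ μ(o ↔ A inside {η ≤ u} ∪ {o}) + μ(o ↔ R_η, o ↮ b)`, `R_η = {v | u(v) < η}`,
`u(v) = μ(v ↮ b)`. [folklore] -/
theorem bad_le_levelProfile_add_badBall (w : Sym2 (Fin n) → unitInterval) (A : Finset (Fin n))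
    (o b : Fin n) (η : ℝ) :
    (prodBernoulli w).real ((⋃ a ∈ A, openConn o a) ∩ (openConn o b)ᶜ) ≤
      (prodBernoulli w).real
          (⋃ a ∈ A, openConnIn ({v : Fin n | η ≤ (prodBernoulli w).real (openConn v b)ᶜ} ∪ {o}) o a) +
        (prodBernoulli w).real
          ((⋃ v ∈ (Finset.univ : Finset (Fin n)).filter
              (fun v => (prodBernoulli w).real (openConn v b)ᶜ < η), openConn o v) ∩ (openConn o b)ᶜ) :=
  le_trans (measureReal_mono (bad_subset_levelProfile_union_badBall w A o b η) (measure_ne_top _ _))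
    (measureReal_union_le _ _)

/-- **Level profile + logarithmic ball price.**  For every `η ≥ 0`,
`μ(o ↔ A, o ↮ b) ≤ μ(o ↔ A inside {η ≤ u} ∪ {o}) + 16 (⌊log₂ |R_η|⌋ + 1) η`, with no hypothesis on the
instance: the bad event of the reliability ball `R_η` (every point `η`-reliable) costs at most
`16 η` per dyadic scale of its footprint (`windowBound`: van den Berg–Häggström–Kahn 2006 Thm 1.3 +
Kozma–Nitzan Lemma 2 + dyadic thinning, landed). [folklore] -/
theorem bad_le_levelProfile_add_logBall (w : Sym2 (Fin n) → unitInterval) (A : Finset (Fin n))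
    (o b : Fin n) {η : ℝ} (hη : 0 ≤ η) :
    (prodBernoulli w).real ((⋃ a ∈ A, openConn o a) ∩ (openConn o b)ᶜ) ≤
      (prodBernoulli w).real
          (⋃ a ∈ A, openConnIn ({v : Fin n | η ≤ (prodBernoulli w).real (openConn v b)ᶜ} ∪ {o}) o a) +
        16 * ((Nat.log 2 ((Finset.univ : Finset (Fin n)).filter
            (fun v => (prodBernoulli w).real (openConn v b)ᶜ < η)).card + 1 : ℕ) : ℝ) * η := by
  set μ := prodBernoulli w with hμ
  set R : Finset (Fin n) := (Finset.univ : Finset (Fin n)).filter (fun v => μ.real (openConn v b)ᶜ < η)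
    with hR
  set L : ℕ := Nat.log 2 R.card + 1 with hL
  have hball : μ.real ((⋃ v ∈ R, openConn o v) ∩ (openConn o b)ᶜ) ≤ 16 * (L : ℝ) * η := by
    have hrel : ∀ v ∈ R, μ.real (openConn v b)ᶜ ≤ η :=
      fun v hv => le_of_lt (Finset.mem_filter.1 hv).2
    have hwin := windowBound n w R o b η 1 L hη le_rfl hrel
    refine le_trans (measureReal_mono ?_ (measure_ne_top _ _)) hwin
    rintro ω ⟨hR', hb⟩
    rw [Set.mem_iUnion₂] at hR'
    obtain ⟨v, hv, hov⟩ := hR'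
    refine ⟨hb, ?_, ?_⟩
    · exact Finset.card_pos.2 ⟨v, Finset.mem_filter.2 ⟨hv, hov⟩⟩
    · rw [one_mul]
      calc (R.filter fun a => ω ∈ openConn o a).card ≤ R.card := Finset.card_filter_le _ _
        _ < 2 ^ L := Nat.lt_pow_succ_log_self one_lt_two _
  calc μ.real ((⋃ a ∈ A, openConn o a) ∩ (openConn o b)ᶜ)
      ≤ μ.real (⋃ a ∈ A, openConnIn ({v : Fin n | η ≤ μ.real (openConn v b)ᶜ} ∪ {o}) o a) +
          μ.real ((⋃ v ∈ R, openConn o v) ∩ (openConn o b)ᶜ) :=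
        bad_le_levelProfile_add_badBall w A o b η
    _ ≤ μ.real (⋃ a ∈ A, openConnIn ({v : Fin n | η ≤ μ.real (openConn v b)ᶜ} ∪ {o}) o a) +
          16 * (L : ℝ) * η := by linarith

end LevelDichotomy

end Summit.CriticalPhenomena.PercolationContinuityZ3.Theorems
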